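import Literature.NumberTheory.DiophantineGeometry.TateAlgorithmThreeTableWalkProofs
import Literature.NumberTheory.EllipticCurves.RootNumberTableThreeKodairaCasesProofs
import Literature.NumberTheory.DiophantineGeometry.TateAlgorithmRingEquivProofs
import Mathlib.RingTheory.Ideal.Int
import HarnessLib

/-!
# The Kodaira symbol at `3` of `E/ℚ` is the Kod column of Rizzo's Table II

`Proofs` file (theorems only; no definition, no named fact) in topic
`NumberTheory/EllipticCurves`, last file of ROW T-PAP3-KOD (cell `b2b-bsdres`, team n1011), the
twin for the Kod column of `RootNumberTableThreeCondExpProofs` (the `v(N)` column, named fact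
`WeierstrassCurve.conductorExponent_eq_tableConductorExponentThree`, discharged there).  It closes the
gap recorded in `RootNumberTableThree` ("What is NOT here": "any proof that
`W.tableKodairaSymbolThree` is the tree's `W.kodairaSymbolAt v` (Tate's algorithm; Papadopoulos
1993)"): for every elliptic curve `E/ℚ` given by ANY Weierstrass equation `W` and the place `v`
above `3`, the Kodaira symbol `W.kodairaSymbolAt v` — the tree's literal implementation of Tate's
algorithm (Silverman *ATAEC* IV.9.4) run on the `v`-adic minimal model — equals
`W.tableKodairaSymbolThree`, the Kod entry of O. G. Rizzo, Compositio Math. 136 (2003), Table II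
(= I. Papadopoulos, J. Number Theory 44 (1993), Table III at `p = 3`, dressed for arbitrary
equations, §1.1–1.2) read on `c₄, c₆, Δ` of `W` (`kodairaSymbolAt_eq_tableKodairaSymbolThree`).
Corollary: the number of components `m_v` (`numComponentsAt`).  The companion
`RootNumberTableThreeKodairaReductionProofs` reads off the reduction type at `3` and the rows of
constant sign.

## Proof

As for the `v(N)` column: `kodairaSymbolAt_eq_padic` (`TateAlgorithmRingEquivProofs`) computes the
symbol on `W ⊗ ℚ₃` over Mathlib's `ℤ₃`; `TateAlgorithm.rowDatum_of_minimal`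
(`TateAlgorithmThreeTableWalkProofs`) places the integral minimal model `M` on one of the 24 rows
with its exact invariants and ITS Kodaira symbol; `RootNumberTableThreeLocalBridgeProofs` /
`…LocalReadingsProofs` transport valuations, residues and the special condition from `M` to the
rational invariants of `W`; `RootNumberTableThreeKodairaRowsProofs` evaluates the Kod entry of the
transcription `Rizzo.tableII` on each row (`RootNumberTableThreeKodairaCasesProofs` and the section
`Star` below, one lemma per Kodaira type); the printed symbol is Tate's in all 24 cases.

## References

* O. G. Rizzo, *Average root numbers for a nonconstant family of elliptic curves*, Compositio
  Math. 136 (2003) 1–23, §1.1–1.2 and Table II (p. 4), column Kod. [Rizzo2003]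
* I. Papadopoulos, *Sur la classification de Néron des courbes elliptiques en caractéristique
  résiduelle 2 et 3*, J. Number Theory 44 (1993) 119–152, Table III (`p = 3`). [Papadopoulos1993]
* J. H. Silverman, *Advanced Topics in the Arithmetic of Elliptic Curves*, GTM 151 (1994), IV.9.4,
  Table 4.1. [Silverman1994]
-/

noncomputable section

open IsDiscreteValuationRing IsDedekindDomain IsLocalRing
open Literature.NumberTheory.DiophantineGeometry Literature.NumberTheory.DiophantineGeometry.TateAlgorithm
open Literature.NumberTheory.EllipticCurves Literature.NumberTheory.EllipticCurves.Rizzo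

namespace WeierstrassCurve

section Star

variable {W : WeierstrassCurve ℚ} {M : WeierstrassCurve ℤ_[3]} {u : ℚ_[3]}

/-- **Type I₀* — rows (2,3,6), (3,≥6,6).**  Along `M = C • W_{ℚ₃}` (`c₄(M) = u⁴c₄`, `c₆(M) = u⁶c₆`,
`Δ(M) = u¹²Δ`), the row datum of `TateAlgorithm.rowDatum_of_minimal` for this type places the
invariants of `W` on a row of Table II whose Kod entry is this very type.
[cite: Rizzo2003, Table II (p. 4), column Kod] [cite: Silverman1994, IV.9.4 and Table 4.1] -/
theorem kodaira_of_row_I0star (hu : u ≠ 0)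
    (hc4 : (M.c₄ : ℚ_[3]) = u ^ 4 * (W.c₄ : ℚ_[3])) (hc6 : (M.c₆ : ℚ_[3]) = u ^ 6 * (W.c₆ : ℚ_[3]))
    (hΔ : (M.Δ : ℚ_[3]) = u ^ 12 * (W.Δ : ℚ_[3])) (hWΔ : W.Δ ≠ 0)
    (hΔv : (addVal ℤ_[3] M.Δ).toNat = 6)
    (hsub : ((addVal ℤ_[3] M.c₄).toNat = 2 ∧ (addVal ℤ_[3] M.c₆).toNat = 3) ∨
        ((addVal ℤ_[3] M.c₄).toNat = 3 ∧ (3 : ℤ_[3]) ^ 6 ∣ M.c₆)) :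
    kodairaOfInvariants W.c₄ W.c₆ W.Δ = KodairaSymbol.Istar 0 := by
  have hΔ' := padicValRat_eq_of_addVal_eq hu hΔ hWΔ hΔv
  simp only [Nat.cast_ofNat] at hΔ'
  rcases hsub with ⟨h4v, h6v⟩ | ⟨h4v, hc6d⟩
  · -- row (2,3,6)
    have h4 := val3_eq_of_addVal_eq hu hc4 h4v (by norm_num)
    have h6 := val3_eq_of_addVal_eq hu hc6 h6v (by norm_num)
    simp only [Nat.cast_ofNat, WithTop.coe_ofNat] at h4 h6
    rw [kodairaOfInvariants_eq_of_shift_zero h4 h6 hΔ' (by decide), kodaira_row_2_3_ge6 (by norm_num)]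
    rfl
  · -- row (3,≥6,6)
    have h4 := val3_eq_of_addVal_eq hu hc4 h4v (by norm_num)
    obtain ⟨b, h6, hbge, -⟩ := exists_val3_of_pow_dvd hu hc6 hc6d
    simp only [Nat.cast_ofNat, WithTop.coe_ofNat] at h4 h6 hbge
    have hs : KellockDokchitser.shift 6 b 3 = 0 :=
      shift_eq_zero (by norm_num) (nonneg_of_forall_coe hbge) (by norm_num) (Or.inl (by norm_num))
    rw [kodairaOfInvariants_eq_of_shift_zero h4 h6 hΔ' hs, kodaira_row_3_ge6_6 (atLeast_of_forall_coe hbge)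
      (by simpa using ne_coe_of_forall_coe hbge (show (4 : ℤ) < 6 by norm_num))
      (by simpa using ne_coe_of_forall_coe hbge (show (5 : ℤ) < 6 by norm_num))]

/-- **Type Iₙ* — rows (2,3,6+n).**  Along `M = C • W_{ℚ₃}` (`c₄(M) = u⁴c₄`, `c₆(M) = u⁶c₆`,
`Δ(M) = u¹²Δ`), the row datum of `TateAlgorithm.rowDatum_of_minimal` for this type places the
invariants of `W` on a row of Table II whose Kod entry is this very type.
[cite: Rizzo2003, Table II (p. 4), column Kod] [cite: Silverman1994, IV.9.4 and Table 4.1] -/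
theorem kodaira_of_row_Instar (hu : u ≠ 0)
    (hc4 : (M.c₄ : ℚ_[3]) = u ^ 4 * (W.c₄ : ℚ_[3])) (hc6 : (M.c₆ : ℚ_[3]) = u ^ 6 * (W.c₆ : ℚ_[3]))
    (hΔ : (M.Δ : ℚ_[3]) = u ^ 12 * (W.Δ : ℚ_[3])) (hWΔ : W.Δ ≠ 0)
    {n : ℕ} (hn1 : 1 ≤ n) (hnΔ : n + 6 = (addVal ℤ_[3] M.Δ).toNat)
    (h4v : (addVal ℤ_[3] M.c₄).toNat = 2) (h6v : (addVal ℤ_[3] M.c₆).toNat = 3) :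
    kodairaOfInvariants W.c₄ W.c₆ W.Δ = KodairaSymbol.Istar n := by
  have hΔ' := padicValRat_eq_of_addVal_eq hu hΔ hWΔ hnΔ.symm
  have h4 := val3_eq_of_addVal_eq hu hc4 h4v (by norm_num)
  have h6 := val3_eq_of_addVal_eq hu hc6 h6v (by norm_num)
  simp only [Nat.cast_ofNat, Nat.cast_add, WithTop.coe_ofNat] at h4 h6 hΔ'
  have hs : KellockDokchitser.shift ((n : ℤ) + 6) 3 2 = 0 :=
    shift_eq_zero (by positivity) (by norm_num) (by norm_num)
      (Or.inr (Or.inl ⟨3, by norm_cast, by norm_num⟩))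
  rw [kodairaOfInvariants_eq_of_shift_zero h4 h6 hΔ' hs, kodaira_row_2_3_ge6 (by omega)]
  congr 1
  omega

/-- **Type IV* — rows (≥4,6,9), (4,7,9), (4,6,10), (≥5,7,11).**  Along `M = C • W_{ℚ₃}` (`c₄(M) = u⁴c₄`, `c₆(M) = u⁶c₆`,
`Δ(M) = u¹²Δ`), the row datum of `TateAlgorithm.rowDatum_of_minimal` for this type places the
invariants of `W` on a row of Table II whose Kod entry is this very type.
[cite: Rizzo2003, Table II (p. 4), column Kod] [cite: Silverman1994, IV.9.4 and Table 4.1] -/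
theorem kodaira_of_row_IVstar (hu : u ≠ 0)
    (hc4 : (M.c₄ : ℚ_[3]) = u ^ 4 * (W.c₄ : ℚ_[3])) (hc6 : (M.c₆ : ℚ_[3]) = u ^ 6 * (W.c₆ : ℚ_[3]))
    (hΔ : (M.Δ : ℚ_[3]) = u ^ 12 * (W.Δ : ℚ_[3])) (hWΔ : W.Δ ≠ 0)
    (hsub : ((3 : ℤ_[3]) ^ 4 ∣ M.c₄ ∧ (addVal ℤ_[3] M.c₆).toNat = 6 ∧ (addVal ℤ_[3] M.Δ).toNat = 9 ∧
          ∃ B₂ B₄ B₆ : ℤ_[3], M.c₄ = 3 ^ 4 * (B₂ ^ 2 - 8 * B₄) ∧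
            M.c₆ = 3 ^ 6 * (-B₂ ^ 3 + 12 * B₂ * B₄ - 24 * B₆) ∧
            IsUnit B₂ ∧ IsUnit B₄ ∧ IsUnit B₆) ∨
        ((addVal ℤ_[3] M.c₄).toNat = 4 ∧ (addVal ℤ_[3] M.c₆).toNat = 7 ∧ (addVal ℤ_[3] M.Δ).toNat = 9) ∨
        ((addVal ℤ_[3] M.c₄).toNat = 4 ∧ (addVal ℤ_[3] M.c₆).toNat = 6 ∧ (addVal ℤ_[3] M.Δ).toNat = 10) ∨
        ((3 : ℤ_[3]) ^ 5 ∣ M.c₄ ∧ (addVal ℤ_[3] M.c₆).toNat = 7 ∧ (addVal ℤ_[3] M.Δ).toNat = 11)) :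
    kodairaOfInvariants W.c₄ W.c₆ W.Δ = KodairaSymbol.IVstar := by
  have h3 : Irreducible (3 : ℤ_[3]) := irreducible_three_padicInt
  rcases hsub with ⟨hc4d, h6v, hΔv, B₂, B₄, B₆, hC4, hC6, hB₂, -, hB₆⟩ | ⟨h4v, h6v, hΔv⟩ |
      ⟨h4v, h6v, hΔv⟩ | ⟨hc4d, h6v, hΔv⟩
  · -- rows (≥4,6,9), special condition FALSE: (4,6,9) and (≥5,6,9)
    obtain ⟨a, h4, hage, hcase⟩ := exists_val3_of_pow_dvd hu hc4 hc4d
    have h6 := val3_eq_of_addVal_eq hu hc6 h6v (by norm_num)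
    have hΔ' := padicValRat_eq_of_addVal_eq hu hΔ hWΔ hΔv
    simp only [Nat.cast_ofNat, WithTop.coe_ofNat] at h4 h6 hΔ' hage
    have hs : KellockDokchitser.shift 9 6 a = 0 :=
      shift_eq_zero (by norm_num) (by norm_num) (nonneg_of_forall_coe hage) (Or.inl (by norm_num))
    have hiff := three_dvd_iff_sp hu hc4 hc6 4 6 B₂ B₄ B₆ hB₂ hC4 hC6 h6v (by norm_num) a hcase
    have hsp : decide ((res9 W.c₆ ^ 2 + 2) % 9 = 3 * c4e a (res9 W.c₄) 4 % 9) = false :=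
      decide_eq_false fun h => (isUnit_iff_not_dvd h3 _).mp hB₆ (hiff.mpr h)
    rw [kodairaOfInvariants_eq_of_shift_zero h4 h6 hΔ' hs]
    -- `a = 4` or `a ≥ 5`
    by_cases ha4 : a = 4
    · subst ha4
      rw [kodaira_row_4_6_9_of_not_sp _ _ _ hsp]
    · have hage5 : ∀ m : ℤ, a = m → (5 : ℤ) ≤ m := by
        intro m hm
        have h4m := hage m hm
        rcases h4m.lt_or_eq with h | h
        · omega
        · exfalso; apply ha4; rw [hm, ← h]; rfl
      have hy : ¬ (res9 W.c₆ % 9 = 4 ∨ res9 W.c₆ % 9 = 5) := by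
        intro hy
        have h0 := sq_add_two_emod_nine_of_emod hy
        have ht : 3 * c4e a (res9 W.c₄) 4 % 9 = 0 :=
          three_mul_c4e_emod_nine_eq_zero _ fun m hm => by have := hage5 m hm; omega
        have : decide ((res9 W.c₆ ^ 2 + 2) % 9 = 3 * c4e a (res9 W.c₄) 4 % 9) = true :=
          decide_eq_true (by rw [h0, ht])
        rw [hsp] at this
        exact Bool.false_ne_true this
      rw [kodaira_row_ge5_6_9_of_not_sp (atLeast_of_forall_coe hage5) ha4 _ _ _ hsp hy]
  · -- row (4,7,9)
    have h4 := val3_eq_of_addVal_eq hu hc4 h4v (by norm_num)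
    have h6 := val3_eq_of_addVal_eq hu hc6 h6v (by norm_num)
    have hΔ' := padicValRat_eq_of_addVal_eq hu hΔ hWΔ hΔv
    simp only [Nat.cast_ofNat, WithTop.coe_ofNat] at h4 h6 hΔ'
    rw [kodairaOfInvariants_eq_of_shift_zero h4 h6 hΔ' (by decide), kodaira_row_4_7_9]
  · -- row (4,6,10)
    have h4 := val3_eq_of_addVal_eq hu hc4 h4v (by norm_num)
    have h6 := val3_eq_of_addVal_eq hu hc6 h6v (by norm_num)
    have hΔ' := padicValRat_eq_of_addVal_eq hu hΔ hWΔ hΔv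
    simp only [Nat.cast_ofNat, WithTop.coe_ofNat] at h4 h6 hΔ'
    rw [kodairaOfInvariants_eq_of_shift_zero h4 h6 hΔ' (by decide), kodaira_row_4_6_10]
  · -- row (≥5,7,11)
    obtain ⟨a, h4, hage, -⟩ := exists_val3_of_pow_dvd hu hc4 hc4d
    have h6 := val3_eq_of_addVal_eq hu hc6 h6v (by norm_num)
    have hΔ' := padicValRat_eq_of_addVal_eq hu hΔ hWΔ hΔv
    simp only [Nat.cast_ofNat, WithTop.coe_ofNat] at h4 h6 hΔ' hage
    have hs : KellockDokchitser.shift 11 7 a = 0 :=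
      shift_eq_zero (by norm_num) (by norm_num) (nonneg_of_forall_coe hage) (Or.inl (by norm_num))
    rw [kodairaOfInvariants_eq_of_shift_zero h4 h6 hΔ' hs, kodaira_row_ge5_7_11 (atLeast_of_forall_coe hage)
      (by simpa using ne_coe_of_forall_coe hage (show (4 : ℤ) < 5 by norm_num))]

/-- **Type III* — rows (≥4,6,9), (4,≥8,9).**  Along `M = C • W_{ℚ₃}` (`c₄(M) = u⁴c₄`, `c₆(M) = u⁶c₆`,
`Δ(M) = u¹²Δ`), the row datum of `TateAlgorithm.rowDatum_of_minimal` for this type places the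
invariants of `W` on a row of Table II whose Kod entry is this very type.
[cite: Rizzo2003, Table II (p. 4), column Kod] [cite: Silverman1994, IV.9.4 and Table 4.1] -/
theorem kodaira_of_row_IIIstar (hu : u ≠ 0)
    (hc4 : (M.c₄ : ℚ_[3]) = u ^ 4 * (W.c₄ : ℚ_[3])) (hc6 : (M.c₆ : ℚ_[3]) = u ^ 6 * (W.c₆ : ℚ_[3]))
    (hΔ : (M.Δ : ℚ_[3]) = u ^ 12 * (W.Δ : ℚ_[3])) (hWΔ : W.Δ ≠ 0)
    (hΔv : (addVal ℤ_[3] M.Δ).toNat = 9)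
    (hsub : ((3 : ℤ_[3]) ^ 4 ∣ M.c₄ ∧ (addVal ℤ_[3] M.c₆).toNat = 6 ∧
          ∃ B₂ B₄ B₆ : ℤ_[3], M.c₄ = 3 ^ 4 * (B₂ ^ 2 - 8 * B₄) ∧
            M.c₆ = 3 ^ 6 * (-B₂ ^ 3 + 12 * B₂ * B₄ - 24 * B₆) ∧
            IsUnit B₂ ∧ IsUnit B₄ ∧ (3 : ℤ_[3]) ∣ B₆) ∨
        ((addVal ℤ_[3] M.c₄).toNat = 4 ∧ (3 : ℤ_[3]) ^ 8 ∣ M.c₆)) :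
    kodairaOfInvariants W.c₄ W.c₆ W.Δ = KodairaSymbol.IIIstar := by
  have h3 : Irreducible (3 : ℤ_[3]) := irreducible_three_padicInt
  have hΔ' := padicValRat_eq_of_addVal_eq hu hΔ hWΔ hΔv
  simp only [Nat.cast_ofNat] at hΔ'
  rcases hsub with ⟨hc4d, h6v, B₂, B₄, B₆, hC4, hC6, hB₂, -, hB₆⟩ | ⟨h4v, hc6d⟩
  · -- row (≥4,6,9), special condition TRUE
    obtain ⟨a, h4, hage, hcase⟩ := exists_val3_of_pow_dvd hu hc4 hc4d
    have h6 := val3_eq_of_addVal_eq hu hc6 h6v (by norm_num)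
    simp only [Nat.cast_ofNat, WithTop.coe_ofNat] at h4 h6 hage
    have hs : KellockDokchitser.shift 9 6 a = 0 :=
      shift_eq_zero (by norm_num) (by norm_num) (nonneg_of_forall_coe hage) (Or.inl (by norm_num))
    have hiff := three_dvd_iff_sp hu hc4 hc6 4 6 B₂ B₄ B₆ hB₂ hC4 hC6 h6v (by norm_num) a hcase
    have hsp : decide ((res9 W.c₆ ^ 2 + 2) % 9 = 3 * c4e a (res9 W.c₄) 4 % 9) = true :=
      decide_eq_true (hiff.mp hB₆)
    rw [kodairaOfInvariants_eq_of_shift_zero h4 h6 hΔ' hs, kodaira_row_ge4_6_9_of_sp (atLeast_of_forall_coe hage) _ _ _ hsp]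
  · -- row (4,≥8,9)
    have h4 := val3_eq_of_addVal_eq hu hc4 h4v (by norm_num)
    obtain ⟨b, h6, hbge, -⟩ := exists_val3_of_pow_dvd hu hc6 hc6d
    simp only [Nat.cast_ofNat, WithTop.coe_ofNat] at h4 h6 hbge
    have hs : KellockDokchitser.shift 9 b 4 = 0 :=
      shift_eq_zero (by norm_num) (nonneg_of_forall_coe hbge) (by norm_num) (Or.inl (by norm_num))
    rw [kodairaOfInvariants_eq_of_shift_zero h4 h6 hΔ' hs, kodaira_row_4_ge8_9 (atLeast_of_forall_coe hbge)
      (by simpa using ne_coe_of_forall_coe hbge (show (6 : ℤ) < 8 by norm_num))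
      (by simpa using ne_coe_of_forall_coe hbge (show (7 : ℤ) < 8 by norm_num))]

end Star

section Main

variable (W : WeierstrassCurve ℚ)

/-- Unfolding `tableKodairaSymbolThree` (definitional). [cite: Rizzo2003, Table II (p. 4), column Kod] -/
theorem tableKodairaSymbolThree_def :
    W.tableKodairaSymbolThree = Rizzo.kodairaOfInvariants W.c₄ W.c₆ W.Δ := rfl

variable [W.IsElliptic]

/-- **The Kodaira symbol at `3` = Table II's Kod, on the `3`-adic minimal model.**  For an elliptic
`W/ℚ`, the Kodaira symbol computed by Tate's algorithm on the integral minimal model of `W ⊗ ℚ₃`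
over `ℤ₃` equals `W.tableKodairaSymbolThree = Rizzo.kodairaOfInvariants W.c₄ W.c₆ W.Δ`.
[cite: Rizzo2003, Table II (p. 4), column Kod] [cite: Papadopoulos1993, Table III (p = 3)]
[cite: Silverman1994, IV.9.4 and Table 4.1] -/
theorem kodairaSymbol_padic_three_eq_tableKodairaSymbolThree :
    (W.baseChange ℚ_[3]).kodairaSymbol ℤ_[3] = W.tableKodairaSymbolThree := by
  classical
  -- the minimal model and its relation to `W`
  set W' := W.baseChange ℚ_[3] with hW'
  set C := (W'.exists_isMinimal ℤ_[3]).choose with hCdef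
  have hmin : W'.minimal ℤ_[3] = C • W' := rfl
  set M := (W'.minimal ℤ_[3]).integralModel ℤ_[3] with hMdef
  have hK : W'.kodairaSymbol ℤ_[3] = M.kodairaSymbolOfMinimal := rfl
  rw [hK, tableKodairaSymbolThree_def]
  set u : ℚ_[3] := ((C.u⁻¹ : ℚ_[3]ˣ) : ℚ_[3]) with hudef
  have hu : u ≠ 0 := Units.ne_zero _
  have hW'c₄ : W'.c₄ = (W.c₄ : ℚ_[3]) := by rw [hW', baseChange, map_c₄]; simp
  have hW'c₆ : W'.c₆ = (W.c₆ : ℚ_[3]) := by rw [hW', baseChange, map_c₆]; simp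
  have hW'Δ : W'.Δ = (W.Δ : ℚ_[3]) := by rw [hW', baseChange, map_Δ]; simp
  have hc4 : (M.c₄ : ℚ_[3]) = u ^ 4 * (W.c₄ : ℚ_[3]) := by
    have h : algebraMap ℤ_[3] ℚ_[3] M.c₄ = (C • W').c₄ := integralModel_c₄_eq ℤ_[3] (W'.minimal ℤ_[3])
    rw [variableChange_c₄, hW'c₄] at h
    exact h
  have hc6 : (M.c₆ : ℚ_[3]) = u ^ 6 * (W.c₆ : ℚ_[3]) := by
    have h : algebraMap ℤ_[3] ℚ_[3] M.c₆ = (C • W').c₆ := integralModel_c₆_eq ℤ_[3] (W'.minimal ℤ_[3])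
    rw [variableChange_c₆, hW'c₆] at h
    exact h
  have hΔ : (M.Δ : ℚ_[3]) = u ^ 12 * (W.Δ : ℚ_[3]) := by
    have h : algebraMap ℤ_[3] ℚ_[3] M.Δ = (C • W').Δ := integralModel_Δ_eq ℤ_[3] (W'.minimal ℤ_[3])
    rw [variableChange_Δ, hW'Δ] at h
    exact h
  have hWΔ : W.Δ ≠ 0 := W.isUnit_Δ.ne_zero
  have hΔ0 : M.Δ ≠ 0 := fun h0 => hWΔ ((eq_zero_iff_of_coe_eq hu hΔ).mp h0)
  -- the hypotheses of the walk over `ℤ₃`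
  haveI : Finite (ResidueField ℤ_[3]) :=
    Finite.of_equiv _ (PadicInt.residueField (p := 3)).toEquiv.symm
  have h2 : IsUnit (2 : ℤ_[3]) := isUnit_two_padicInt_three
  have h3 : Irreducible (3 : ℤ_[3]) := by simpa using PadicInt.irreducible_p (p := 3)
  have hmin11 : ∀ D : VariableChange ℤ_[3], D.u = 1 →
      uniformizer ℤ_[3] ∣ (D • M).a₁ → uniformizer ℤ_[3] ^ 2 ∣ (D • M).a₂ →
      uniformizer ℤ_[3] ^ 3 ∣ (D • M).a₃ → uniformizer ℤ_[3] ^ 4 ∣ (D • M).a₄ →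
      uniformizer ℤ_[3] ^ 6 ∣ (D • M).a₆ → False := by
    intro D _ h1 h2' h3' h4 h6
    have hM : (M.baseChange ℚ_[3]).IsMinimal ℤ_[3] := by
      rw [hMdef, baseChange_integralModel_eq ℤ_[3] (W'.minimal ℤ_[3])]
      infer_instance
    exact not_isMinimal_of_pow_dvd ℚ_[3] hΔ0 D h1 h2' h3' h4 h6 hM
  -- THE WALK: one case per Kodaira type (the rows of the table)
  have hrow := rowDatum_of_minimal h2 h3 M hΔ0 hmin11
  rcases hrow with ⟨hK, hΔ3, hsub⟩ | ⟨n, hn1, hK, hΔn, hc4nd, hc6nd⟩ | ⟨hK, hsub⟩ |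
      ⟨hK, hΔv, hsub⟩ | ⟨hK, hsub⟩ | ⟨hK, hΔv, hsub⟩ | ⟨n, hn1, hK, hnΔ, h4v, h6v⟩ |
      ⟨hK, hsub⟩ | ⟨hK, hΔv, hsub⟩ | ⟨hK, hsub⟩
  · rw [hK]; exact (kodaira_of_row_I0 hu hc4 hc6 hΔ hWΔ hΔ3 hsub).symm
  · rw [hK]; exact (kodaira_of_row_In hu hc4 hc6 hΔ hWΔ hn1 hΔn hc4nd hc6nd).symm
  · rw [hK]; exact (kodaira_of_row_II hu hc4 hc6 hΔ hWΔ hsub).symm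
  · rw [hK]; exact (kodaira_of_row_III hu hc4 hc6 hΔ hWΔ hΔv hsub).symm
  · rw [hK]; exact (kodaira_of_row_IV hu hc4 hc6 hΔ hWΔ hsub).symm
  · rw [hK]; exact (kodaira_of_row_I0star hu hc4 hc6 hΔ hWΔ hΔv hsub).symm
  · rw [hK]; exact (kodaira_of_row_Instar hu hc4 hc6 hΔ hWΔ hn1 hnΔ h4v h6v).symm
  · rw [hK]; exact (kodaira_of_row_IVstar hu hc4 hc6 hΔ hWΔ hsub).symm
  · rw [hK]; exact (kodaira_of_row_IIIstar hu hc4 hc6 hΔ hWΔ hΔv hsub).symm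
  · rw [hK]; exact (kodaira_of_row_IIstar hu hc4 hc6 hΔ hWΔ hsub).symm

end Main

section AtThree

open Rat.HeightOneSpectrum

variable {R : Type*} [CommRing R] [IsDedekindDomain R] [Algebra R ℚ] [IsFractionRing R ℚ]
  [IsIntegralClosure R ℤ ℚ]

/-- **The Kodaira symbol at `3` of `E/ℚ` is the Kod column of Table II** (Rizzo 2003, Table II,
after Halberstadt 1998 and Tate's algorithm; Papadopoulos 1993, Table III at `p = 3`), for a place
`v` of ANY integer ring `R` of `ℚ` (`ℤ` or `𝓞 ℚ`) above the prime `3`: `W.kodairaSymbolAt v`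
(Tate's algorithm over the completed local ring at `v`) equals `W.tableKodairaSymbolThree`, the Kod
entry of Table II read on `c₄, c₆, Δ` of the given equation `W` (§1.1–1.2: any equation of `E`
over `ℚ` may be used).  Proof: `kodairaSymbolAt_eq_padic` and
`kodairaSymbol_padic_three_eq_tableKodairaSymbolThree`.
[cite: Rizzo2003, Table II (p. 4), column Kod] [cite: Papadopoulos1993, Table III (p = 3)]
[cite: Silverman1994, IV.9.4 and Table 4.1] -/
theorem kodairaSymbolAt_eq_tableKodairaSymbolThree_of_primesEquiv_eq (v : HeightOneSpectrum R)
    (W : WeierstrassCurve ℚ) [W.IsElliptic] (hv : ((primesEquiv v : Nat.Primes) : ℕ) = 3) :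
    W.kodairaSymbolAt v = W.tableKodairaSymbolThree := by
  rw [kodairaSymbolAt_eq_padic v W]
  generalize primesEquiv v = q at hv ⊢
  obtain ⟨q, hqp⟩ := q
  simp only at hv
  subst hv
  exact kodairaSymbol_padic_three_eq_tableKodairaSymbolThree W

/-- The number `m_v` of components of the special fibre of the minimal regular model at a place
`v` above `3` of any integer ring `R` of `ℚ` (`W.numComponentsAt v`, the `m_v` of Ogg's formula) is
read from the Kod column of Table II (Silverman *ATAEC* IV, Table 4.1).
[cite: Rizzo2003, Table II (p. 4), column Kod] [cite: Silverman1994, IV.9.4 and Table 4.1] -/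
theorem numComponentsAt_eq_numComponents_tableKodairaSymbolThree_of_primesEquiv_eq
    (v : HeightOneSpectrum R) (W : WeierstrassCurve ℚ) [W.IsElliptic]
    (hv : ((primesEquiv v : Nat.Primes) : ℕ) = 3) :
    W.numComponentsAt v = W.tableKodairaSymbolThree.numComponents := by
  rw [numComponentsAt, kodairaSymbolAt_eq_tableKodairaSymbolThree_of_primesEquiv_eq v W hv]

/-- The residue ring of `ℤ` at the finite place `v` has characteristic `p_v = natGenerator v`
(`v.asIdeal = (p_v)`, Mathlib `Rat.HeightOneSpectrum.span_natGenerator`, `Int.ringChar_idealQuot`);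
the statement of `Literature.NumberTheory.EllipticCurves.Rat.ringChar_int_quotient_asIdeal`
(`BSDConductor`), reproved here to keep the imports small. [folklore] -/
private theorem ringChar_int_quotient_asIdeal_eq_natGenerator (v : HeightOneSpectrum ℤ) :
    ringChar (ℤ ⧸ v.asIdeal) = natGenerator v := by
  have he : Rat.IsIntegralClosure.intEquiv ℤ = RingEquiv.refl ℤ :=
    RingEquiv.ext fun x ↦ by simp
  have hI : v.asIdeal = Ideal.span {(natGenerator v : ℤ)} := by
    rw [span_natGenerator, he]
    exact (Ideal.map_id _).symm
  rw [hI]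
  exact Int.ringChar_idealQuot _

variable (W : WeierstrassCurve ℚ) [W.IsElliptic] {v : HeightOneSpectrum ℤ}

/-- **The Kodaira symbol at `3` of `E/ℚ` is the Kod column of Table II**, at the place `v` of `ℤ`
of residue characteristic `3` (the shape of the named fact
`WeierstrassCurve.conductorExponent_eq_tableConductorExponentThree` for the `v(N)` column): for
every elliptic curve `E/ℚ` given by ANY Weierstrass equation `W`, the Kodaira symbol
`W.kodairaSymbolAt v` of Tate's algorithm (Silverman *ATAEC* IV.9.4, the tree's
`DiophantineGeometry.TateAlgorithm`) is `W.tableKodairaSymbolThree`, Rizzo's Table II, column Kod,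
read on `c₄, c₆, Δ` of `W`.
[cite: Rizzo2003, Table II (p. 4), column Kod] [cite: Papadopoulos1993, Table III (p = 3)]
[cite: Silverman1994, IV.9.4 and Table 4.1] -/
theorem kodairaSymbolAt_eq_tableKodairaSymbolThree (hv : ringChar (ℤ ⧸ v.asIdeal) = 3) :
    W.kodairaSymbolAt v = W.tableKodairaSymbolThree := by
  rw [ringChar_int_quotient_asIdeal_eq_natGenerator] at hv
  exact kodairaSymbolAt_eq_tableKodairaSymbolThree_of_primesEquiv_eq v W hv

/-- The number `m_v` of components of the special fibre of the minimal regular model at the place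
`v ∣ 3` (`W.numComponentsAt v`, the `m_v` of Ogg's formula) is read from the Kod column of Table
II (Silverman *ATAEC* IV, Table 4.1). [cite: Rizzo2003, Table II (p. 4), column Kod]
[cite: Silverman1994, IV.9.4 and Table 4.1] -/
theorem numComponentsAt_eq_numComponents_tableKodairaSymbolThree
    (hv : ringChar (ℤ ⧸ v.asIdeal) = 3) :
    W.numComponentsAt v = W.tableKodairaSymbolThree.numComponents := by
  rw [numComponentsAt, kodairaSymbolAt_eq_tableKodairaSymbolThree W hv]

end AtThree

end WeierstrassCurve

end
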